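import Literature.Topology.Immersions.ProjBundleOrientation
import Literature.Topology.Immersions.ProjBundleBasic
import HarnessLib

/-!
# Pull-backs of bundle orientations

Topic `Literature/Topology/Immersions`. The pull-back `φ^*E` of an oriented projection-field
bundle along a `C^∞` map `φ : N → M` (`ProjBundle.pullback`, `ProjBundleBasic.lean`) is
oriented by `y ↦ o (φ y)` (Milnor–Stasheff, *Characteristic Classes* (1974), §9 p. 97: "any
bundle induced from an oriented bundle is canonically oriented"); in particular restrictions to
open submanifolds are oriented.

* `ProjBundle.pullback_frameAt` — the bundle-chart frames of `φ^*E` at `y₀` are the frames of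
  `E` at `φ y₀`, read at `φ y` (definitional);
* `ProjBundle.IsOrientation.pullback`.

Everything here is proved; no definitions, no named facts.

## References

* J. Milnor, J. Stasheff, *Characteristic Classes* (1974), §9 p. 97. [MilnorStasheff1974]
-/

open scoped Manifold ContDiff Topology
open Set Function Module Filter

noncomputable section

namespace Literature.Topology.Immersions

/-- Local notation: `𝔼 n` is the model Euclidean space `EuclideanSpace ℝ (Fin n)`. -/
local notation "𝔼 " n:arg => EuclideanSpace ℝ (Fin n)

namespace ProjBundle

variable {n n' m k : ℕ} {M : Type*} [TopologicalSpace M] [ChartedSpace (𝔼 n) M]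
  {N : Type*} [TopologicalSpace N] [ChartedSpace (𝔼 n') N]

/-- The bundle-chart frames of the pull-back are those of `E` at the image points. [folklore] -/
theorem pullback_frameAt (P : ProjBundle n m k M) (φ : N → M) (hφ : ContMDiff (𝓡 n') (𝓡 n) ∞ φ)
    (y₀ y : N) : (P.pullback φ hφ).frameAt y₀ y = P.frameAt (φ y₀) (φ y) := rfl

/-- The chart orientations of the pull-back are those of `E` at the image points. [folklore] -/
theorem pullback_chartOrientation (P : ProjBundle n m k M) (φ : N → M)
    (hφ : ContMDiff (𝓡 n') (𝓡 n) ∞ φ) {y₀ y : N} (hy : y ∈ (P.pullback φ hφ).goodSet y₀)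
    (hx : φ y ∈ P.goodSet (φ y₀)) :
    (P.pullback φ hφ).chartOrientation hy = P.chartOrientation hx := rfl

variable {P : ProjBundle n m k M} in
/-- **The pull-back of an oriented bundle is oriented** by `y ↦ o (φ y)`.
[cite: MilnorStasheff1974, §9 p. 97] -/
theorem IsOrientation.pullback {o : ∀ x, Orientation ℝ (P.fibre x) (Fin k)} (h : P.IsOrientation o)
    (φ : N → M) (hφ : ContMDiff (𝓡 n') (𝓡 n) ∞ φ) :
    (P.pullback φ hφ).IsOrientation fun y => o (φ y) := by
  refine ⟨fun y₀ => ?_⟩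
  have h1 := hφ.continuous.continuousAt.eventually (h.eventually_iff (φ y₀))
  have h2 : ∀ᶠ y in 𝓝 y₀, φ y ∈ (chartAt (𝔼 n) (φ y₀)).source :=
    hφ.continuous.continuousAt.eventually
      ((chartAt (𝔼 n) (φ y₀)).open_source.mem_nhds (mem_chart_source _ _))
  filter_upwards [h1, h2] with y hy hys
  intro hyg
  have hx : φ y ∈ P.goodSet (φ y₀) := ⟨hys, hyg.2⟩
  rw [pullback_chartOrientation P φ hφ hyg hx,
    pullback_chartOrientation P φ hφ ((P.pullback φ hφ).mem_goodSet_self y₀) (P.mem_goodSet_self _)]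
  exact hy hx

end ProjBundle

end Literature.Topology.Immersions
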